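import Summits.QuantumFields.BalabanUV.Beta.GAN24.T2UnitSplitFrom
import Summits.QuantumFields.BalabanUV.Beta.MixedJetTablesPlug

/-!
# `BalabanUV.Beta.GAN24.T2UnitSplitFromRoot` — binder row G-an2-4 / (CONV-C), W-slot, road «W3» (F1): THE LEVEL SUMS FROM AN ARBITRARY
# START LEVEL `s` (and the `s = 1` text of the re-cut (R1)) AT an1's BORDER OF ANY BOX ROOT `r` (referee condition (w9), row side for F1)
# (G-an2-4 FORMAL swarm, leaf-01 lineage, gen 16; «W3-F1-FROM-ROOT*»)

NOT IN PRINT; OUR BOOKKEEPING.  HONEST FRAMING (cell contract, verbatim): «discharging `BetaPertH` makes Bałaban's UV stability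
UNCONDITIONAL — a real constructive-QFT result; it is NOT the continuum limit and NOT the Clay problem.»  HONEST DEPENDENCY (verbatim):
«continuum YM on T⁴ ⇐ BetaPertH ∧ nine spine estimates (0/9 proved); BetaPertH ⇐ (D1) ∧ (D4) ∧ CAP+tail; G-an2-4 gates asym, D1 and
NE2/3/4.»

WHY.  Referee 2's round 61 (`HOME/b2b-balaban-gan24-formalise-ref2/gen31/REF2-DAG-AUDIT-r61.md`) makes the «unroll from `D₁`» repair (R1) of
END #2 `WSlotT2OfPieces.rate_of_rows` / `t2Drift_of_rows` (p213240) the re-cut OF RECORD (R61-2 (b): the difference tower is unrolled from its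
member `D♮₁ = T♮₂ − T♮₁`, member `0` absorbed by a shape binder), and keeps condition (w9) OPEN at END level (§E: the ENDs hard-code an1's
BASE-root border `vh₂S d Lc` while an1's (D1) plug of record is the CENTRED root; an END re-typing takes the border as a PARAMETER).  On the
(F1) row side the tree holds: base root × from level `s` / `s = 1` (`T2UnitSplitFrom` §3, p214222), generic border × from `s` (`T2UnitSplitFrom`
§2), an1 ANY root × from level `0` (`T2UnitSplitBorder` §2/§3, p213806).  This module supplies the one missing cell — an1 ANY root × from
`s ≥ 1` — so that the re-cut END #2′ finds its `hsplit` by `exact` at every box root `r` (in particular the centred root `ctrOff (d+1) Lc`,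
`AveragingContoursRooted.ctrOff_mem_box`), beside leaf-08's any-root (F4) rows `W3SourceRowsRoot.hb_an1_three` / `hf_an1_three`:
* §1 **(F1a)/(F1b) FROM LEVEL `s` AT an1's BORDER `vh₂SAt (toSite r) Lc` OF ANY ROOT, generic mixed table, MODULO `hmix` ONLY** —
  `unitS₂_T2Of_eq_transport_add_sum_from_vh₂SAt_of_mix`, `unitS₂_T2Of_sub_eq_transport_add_sum_from_vh₂SAt_of_mix` (all `s n`) and the `s = 1`
  numerals text `unitS₂_T2Of_sub_eq_transport_add_sum_one_vh₂SAt_of_mix` (`D♮_{n+1} = transport 𝒜 2 n D♮_1 + Σ_{m<n} transport 𝒜 (m+3) (n−1−m) f♮_{m+1}`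
  — the `hsplit` of `rate_of_rows` at `D := fun n ↦ D♮ (n+1)`, `P := fun m k ↦ transport 𝒜 (m+2) k`, `f := fun m ↦ f♮ (m+1)`, rooted at `r`):
  `T2UnitSplitFrom.…_from_of_shapes` at `Bd := vh₂SAt (toSite r) Lc`, border shape `MixedJetTablesPlug.hB_an1` BY NAME, off-diagonal entries by `rfl`;
* §2 **THE SAME WITH BOTH an1 TABLES AT ROOT `r` — NO TABLE HYPOTHESIS LEFT** (`mixFF := mixFFAt (toSite r) Lc`, `hmix := MixedJetTablesPlug.hmix_an1`):
  `unitS₂_T2Of_eq_transport_add_sum_from_an1`, `unitS₂_T2Of_sub_eq_transport_add_sum_from_an1`, `unitS₂_T2Of_sub_eq_transport_add_sum_one_an1`;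
  residual binders `1 ≤ Lc`, `r ∈ box (d+1) Lc`.
At `s = 0` these are the landed texts of `T2UnitSplitBorder` §2/§3; at the base root they are `T2UnitSplitFrom` §3 (neither restated here).
[folklore] composition of tree theorems; every constant per level EXISTENTIAL; asserts NO j-uniform bound, NO zero mode, NO sum rule;
(F1) is bookkeeping and discharges NO estimate; instantiates NO wall binder (the D1 wall's K 2/2 and S 2/2 binder pairs are tree theorems at
d = 3, Lc ≥ 2 — `KSlotAssembly.convCKWall_holds`, `StencilSlotSAllThree.hS_hSall_three_of_diffRows` fed by name; W 0/2, this module: none);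
«T2Shape»/«T2SupRate»/«T2Drift» OPEN, NOT IN PRINT; discharges NOTHING of (hW₂, hW₂all); NOT «W-slot closed», NEVER «G-an2-4 closed»;
NOT BetaPertH, NOT continuum, NOT Clay.
-/

noncomputable section

open Finset
open scoped BigOperators
open Literature.MathematicalPhysics.QuantumFieldTheory
open Literature.MathematicalPhysics.QuantumFieldTheory.Balaban1983to89
open Literature.MathematicalPhysics.QuantumFieldTheory.Balaban1983to89.Beta
open Literature.MathematicalPhysics.QuantumFieldTheory.Balaban1983to89.Beta.AffineAveraging (box toSite)
open ExpKernelCalculus (MKer)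
open OneStepResolventKernel (Fib)
open OneStepKernelFamily (KInvStep)
open StepJetData (mfNeg)
open SecondOrderResponse (W2SymOfK LocStencilFM)
open BalabanCompositeJets (LocStencil₂)
open BalabanStepJetsSucc (mmRead)
open BalabanStepW2 (K3OfK Spure M1 M2Of T2Of)
open AveragingMixedJetTables (vh₂SAt mixFFAt)
open Summit.QuantumFields.BalabanUV.Beta.HessKerDressedUnits (unitK unitS)
open Summit.QuantumFields.BalabanUV.Beta.SecondOrderUnits (unitM unitS₂ unitM₂)
open Summit.QuantumFields.BalabanUV.Beta.MixedJetTablesPlug (hB_an1 hmix_an1)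
open Summit.QuantumFields.BalabanUV.Beta.GAN24.CombesThomas (sfStep smStep)
open Summit.QuantumFields.BalabanUV.Beta.GAN24.T2RecursionAffine (lin4)
open Summit.QuantumFields.BalabanUV.Beta.GAN24.AffineUnroll (transport)
open Summit.QuantumFields.BalabanUV.Beta.GAN24.T2UnitSplitFrom (unitS₂_T2Of_eq_transport_add_sum_from_of_shapes
  unitS₂_T2Of_sub_eq_transport_add_sum_from_of_shapes)

namespace Summit.QuantumFields.BalabanUV.Beta.GAN24.T2UnitSplitFromRoot

variable {d : ℕ}

/-! ## §1 (F1a)/(F1b) FROM LEVEL `s` AT an1's BORDER TABLE OF ANY ROOT, generic mixed table: modulo `hmix` only -/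

section AnyRoot

variable {Lc : ℕ} [NeZero Lc] {r : Fin (d + 1) → ℕ} (cE cVH cΛ cE₂ cB : ℝ) (Tc : Fin 4 → Fin 4 → Fin 4 → Fin 4 → ℝ)
  (mixFF : Fin (d + 1) → (Fin (d + 1) → ℤ) → Fin (d + 1) → (Fin (d + 1) → ℤ) → MKer (d + 1) (Fib d))

/-- [folklore] **(F1a) FROM LEVEL `s` AT an1's BORDER `vh₂SAt (toSite r) Lc` OF ANY BOX ROOT `r`, MODULO `hmix` ONLY**: for all `s n`,
`T♮_{n+s} = transport 𝒜 s n T♮_s + Σ_{m<n} transport 𝒜 (m+1+s) (n−1−m) b♮_{m+s}` — `T2UnitSplitFrom.unitS₂_T2Of_eq_transport_add_sum_from_of_shapes` at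
`Bd := vh₂SAt (toSite r) Lc`, border shape by `MixedJetTablesPlug.hB_an1` (BY NAME), off-diagonal entries `0` by `rfl`.  (`s = 0` is
`T2UnitSplitBorder.unitS₂_T2Of_eq_transport_add_sum_vh₂SAt_of_mix`.) -/
theorem unitS₂_T2Of_eq_transport_add_sum_from_vh₂SAt_of_mix (hLc : 1 ≤ Lc) (hr : r ∈ box (d + 1) Lc)
    (hmix : ∃ C δ : ℝ, 0 < δ ∧ LocStencilFM Lc mixFF C δ) (s n : ℕ) :
    unitS₂ (sfStep Lc (n + s)) (smStep d Lc (n + s)) (T2Of d Lc cE cVH cΛ cE₂ cB Tc (vh₂SAt (toSite r) Lc) mixFF (n + s)) =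
      transport (fun j => lin4 (cE₂ * (Lc : ℝ) ^ (2 * (d + 1))) (unitK (sfStep Lc j) (smStep d Lc j) (KInvStep (d := d) Lc j)) Lc) s n
            (unitS₂ (sfStep Lc s) (smStep d Lc s) (T2Of d Lc cE cVH cΛ cE₂ cB Tc (vh₂SAt (toSite r) Lc) mixFF s)) +
        ∑ m ∈ Finset.range n, transport (fun j => lin4 (cE₂ * (Lc : ℝ) ^ (2 * (d + 1))) (unitK (sfStep Lc j) (smStep d Lc j) (KInvStep (d := d) Lc j)) Lc) (m + 1 + s) (n - 1 - m)
              (fun κ u κ' u' => (cE₂ * (Lc : ℝ) ^ (2 * (d + 1))) • mmRead Lc (K3OfK (unitK (sfStep Lc (m + s)) (smStep d Lc (m + s)) (KInvStep (d := d) Lc (m + s))) Lc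
                (unitS (sfStep Lc (m + s)) (smStep d Lc (m + s)) (Spure d Lc cE cVH cΛ (m + s))) (unitM (sfStep Lc (m + s)) (smStep d Lc (m + s)) (M1 d Lc cΛ (m + s)))
                (W2SymOfK (unitK (sfStep Lc (m + s)) (smStep d Lc (m + s)) (KInvStep (d := d) Lc (m + s))) Lc (unitS (sfStep Lc (m + s)) (smStep d Lc (m + s)) (Spure d Lc cE cVH cΛ (m + s)))
                (unitM (sfStep Lc (m + s)) (smStep d Lc (m + s)) (M1 d Lc cΛ (m + s))) 0 (unitM₂ (sfStep Lc (m + s)) (smStep d Lc (m + s)) (M2Of d Lc mixFF (m + s)))) κ u κ' u') +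
                cB • mfNeg ((vh₂SAt (toSite r) Lc) κ u κ' u')) :=
  unitS₂_T2Of_eq_transport_add_sum_from_of_shapes cE cVH cΛ cE₂ cB Tc mixFF hLc (vh₂SAt (toSite r) Lc) (fun _ _ _ _ _ _ _ _ => rfl)
    (fun _ _ _ _ _ _ _ _ => rfl) (hB_an1 hLc hr) hmix s n

/-- [folklore] **(F1b) FROM LEVEL `s` AT an1's BORDER `vh₂SAt (toSite r) Lc` OF ANY BOX ROOT `r`, MODULO `hmix` ONLY**: for all `s n`, with
`D♮_j := T♮_{j+1} − T♮_j` and the forcing `f♮_j := (𝒜_{j+1} − 𝒜_j) T♮_j + (b♮_{j+1} − b♮_j)` of the landed (F1b),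
`D♮_{n+s} = transport 𝒜 (1+s) n D♮_s + Σ_{m<n} transport 𝒜 (m+2+s) (n−1−m) f♮_{m+s}` — `T2UnitSplitFrom.unitS₂_T2Of_sub_eq_transport_add_sum_from_of_shapes`
at `Bd := vh₂SAt (toSite r) Lc`.  (`s = 0` is `T2UnitSplitBorder.unitS₂_T2Of_sub_eq_transport_add_sum_vh₂SAt_of_mix`.) -/
theorem unitS₂_T2Of_sub_eq_transport_add_sum_from_vh₂SAt_of_mix (hLc : 1 ≤ Lc) (hr : r ∈ box (d + 1) Lc)
    (hmix : ∃ C δ : ℝ, 0 < δ ∧ LocStencilFM Lc mixFF C δ) (s n : ℕ) :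
    (fun κ u κ' u' => unitS₂ (sfStep Lc (n + 1 + s)) (smStep d Lc (n + 1 + s)) (T2Of d Lc cE cVH cΛ cE₂ cB Tc (vh₂SAt (toSite r) Lc) mixFF (n + 1 + s)) κ u κ' u' -
        unitS₂ (sfStep Lc (n + s)) (smStep d Lc (n + s)) (T2Of d Lc cE cVH cΛ cE₂ cB Tc (vh₂SAt (toSite r) Lc) mixFF (n + s)) κ u κ' u') =
      transport (fun j => lin4 (cE₂ * (Lc : ℝ) ^ (2 * (d + 1))) (unitK (sfStep Lc j) (smStep d Lc j) (KInvStep (d := d) Lc j)) Lc) (1 + s) n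
            (fun κ u κ' u' =>
          unitS₂ (sfStep Lc (1 + s)) (smStep d Lc (1 + s)) (T2Of d Lc cE cVH cΛ cE₂ cB Tc (vh₂SAt (toSite r) Lc) mixFF (1 + s)) κ u κ' u' -
            unitS₂ (sfStep Lc s) (smStep d Lc s) (T2Of d Lc cE cVH cΛ cE₂ cB Tc (vh₂SAt (toSite r) Lc) mixFF s) κ u κ' u') +
        ∑ m ∈ Finset.range n, transport (fun j => lin4 (cE₂ * (Lc : ℝ) ^ (2 * (d + 1))) (unitK (sfStep Lc j) (smStep d Lc j) (KInvStep (d := d) Lc j)) Lc) (m + 2 + s) (n - 1 - m)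
          ((lin4 (cE₂ * (Lc : ℝ) ^ (2 * (d + 1))) (unitK (sfStep Lc (m + 1 + s)) (smStep d Lc (m + 1 + s)) (KInvStep (d := d) Lc (m + 1 + s))) Lc
                (unitS₂ (sfStep Lc (m + s)) (smStep d Lc (m + s)) (T2Of d Lc cE cVH cΛ cE₂ cB Tc (vh₂SAt (toSite r) Lc) mixFF (m + s))) -
              lin4 (cE₂ * (Lc : ℝ) ^ (2 * (d + 1))) (unitK (sfStep Lc (m + s)) (smStep d Lc (m + s)) (KInvStep (d := d) Lc (m + s))) Lc
                    (unitS₂ (sfStep Lc (m + s)) (smStep d Lc (m + s)) (T2Of d Lc cE cVH cΛ cE₂ cB Tc (vh₂SAt (toSite r) Lc) mixFF (m + s)))) +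
            ((fun κ u κ' u' => (cE₂ * (Lc : ℝ) ^ (2 * (d + 1))) • mmRead Lc (K3OfK (unitK (sfStep Lc (m + 1 + s)) (smStep d Lc (m + 1 + s)) (KInvStep (d := d) Lc (m + 1 + s))) Lc
                (unitS (sfStep Lc (m + 1 + s)) (smStep d Lc (m + 1 + s)) (Spure d Lc cE cVH cΛ (m + 1 + s))) (unitM (sfStep Lc (m + 1 + s)) (smStep d Lc (m + 1 + s)) (M1 d Lc cΛ (m + 1 + s)))
                (W2SymOfK (unitK (sfStep Lc (m + 1 + s)) (smStep d Lc (m + 1 + s)) (KInvStep (d := d) Lc (m + 1 + s))) Lc (unitS (sfStep Lc (m + 1 + s)) (smStep d Lc (m + 1 + s)) (Spure d Lc cE cVH cΛ (m + 1 + s)))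
                (unitM (sfStep Lc (m + 1 + s)) (smStep d Lc (m + 1 + s)) (M1 d Lc cΛ (m + 1 + s))) 0 (unitM₂ (sfStep Lc (m + 1 + s)) (smStep d Lc (m + 1 + s)) (M2Of d Lc mixFF (m + 1 + s)))) κ u κ' u') +
                cB • mfNeg ((vh₂SAt (toSite r) Lc) κ u κ' u')) -
                  (fun κ u κ' u' => (cE₂ * (Lc : ℝ) ^ (2 * (d + 1))) • mmRead Lc (K3OfK (unitK (sfStep Lc (m + s)) (smStep d Lc (m + s)) (KInvStep (d := d) Lc (m + s))) Lc
                (unitS (sfStep Lc (m + s)) (smStep d Lc (m + s)) (Spure d Lc cE cVH cΛ (m + s))) (unitM (sfStep Lc (m + s)) (smStep d Lc (m + s)) (M1 d Lc cΛ (m + s)))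
                (W2SymOfK (unitK (sfStep Lc (m + s)) (smStep d Lc (m + s)) (KInvStep (d := d) Lc (m + s))) Lc (unitS (sfStep Lc (m + s)) (smStep d Lc (m + s)) (Spure d Lc cE cVH cΛ (m + s)))
                (unitM (sfStep Lc (m + s)) (smStep d Lc (m + s)) (M1 d Lc cΛ (m + s))) 0 (unitM₂ (sfStep Lc (m + s)) (smStep d Lc (m + s)) (M2Of d Lc mixFF (m + s)))) κ u κ' u') +
                cB • mfNeg ((vh₂SAt (toSite r) Lc) κ u κ' u')))) :=
  unitS₂_T2Of_sub_eq_transport_add_sum_from_of_shapes cE cVH cΛ cE₂ cB Tc mixFF hLc (vh₂SAt (toSite r) Lc) (fun _ _ _ _ _ _ _ _ => rfl)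
    (fun _ _ _ _ _ _ _ _ => rfl) (hB_an1 hLc hr) hmix s n

/-- [folklore] **(F1b) FROM LEVEL 1 AT an1's BORDER OF ANY BOX ROOT `r` — THE `hsplit` OF THE RE-CUT (R1) «UNROLL FROM D₁», ROOTED, in the
consumer's numerals**: for all `n`, `D♮_{n+1} = transport 𝒜 2 n D♮_1 + Σ_{m<n} transport 𝒜 (m+3) (n−1−m) f♮_{m+1}`, i.e. the `hsplit` binder of
`WSlotT2OfPieces.rate_of_rows` (p213240) at `D := fun n ↦ D♮ (n+1)`, `P := fun m k ↦ transport 𝒜 (m+2) k`, `f := fun m ↦ f♮ (m+1)` for the tables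
rooted at `r` (modulo `hmix` only).  The previous theorem at `s := 1`; stated separately so that an END binder at root `r` is met by `exact`
(the base-root text is `T2UnitSplitFrom.unitS₂_T2Of_sub_eq_transport_add_sum_one_vh₂S_of_mix`). -/
theorem unitS₂_T2Of_sub_eq_transport_add_sum_one_vh₂SAt_of_mix (hLc : 1 ≤ Lc) (hr : r ∈ box (d + 1) Lc)
    (hmix : ∃ C δ : ℝ, 0 < δ ∧ LocStencilFM Lc mixFF C δ) (n : ℕ) :
    (fun κ u κ' u' => unitS₂ (sfStep Lc (n + 2)) (smStep d Lc (n + 2)) (T2Of d Lc cE cVH cΛ cE₂ cB Tc (vh₂SAt (toSite r) Lc) mixFF (n + 2)) κ u κ' u' -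
        unitS₂ (sfStep Lc (n + 1)) (smStep d Lc (n + 1)) (T2Of d Lc cE cVH cΛ cE₂ cB Tc (vh₂SAt (toSite r) Lc) mixFF (n + 1)) κ u κ' u') =
      transport (fun j => lin4 (cE₂ * (Lc : ℝ) ^ (2 * (d + 1))) (unitK (sfStep Lc j) (smStep d Lc j) (KInvStep (d := d) Lc j)) Lc) 2 n
            (fun κ u κ' u' =>
          unitS₂ (sfStep Lc 2) (smStep d Lc 2) (T2Of d Lc cE cVH cΛ cE₂ cB Tc (vh₂SAt (toSite r) Lc) mixFF 2) κ u κ' u' -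
            unitS₂ (sfStep Lc 1) (smStep d Lc 1) (T2Of d Lc cE cVH cΛ cE₂ cB Tc (vh₂SAt (toSite r) Lc) mixFF 1) κ u κ' u') +
        ∑ m ∈ Finset.range n, transport (fun j => lin4 (cE₂ * (Lc : ℝ) ^ (2 * (d + 1))) (unitK (sfStep Lc j) (smStep d Lc j) (KInvStep (d := d) Lc j)) Lc) (m + 3) (n - 1 - m)
          ((lin4 (cE₂ * (Lc : ℝ) ^ (2 * (d + 1))) (unitK (sfStep Lc (m + 2)) (smStep d Lc (m + 2)) (KInvStep (d := d) Lc (m + 2))) Lc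
                (unitS₂ (sfStep Lc (m + 1)) (smStep d Lc (m + 1)) (T2Of d Lc cE cVH cΛ cE₂ cB Tc (vh₂SAt (toSite r) Lc) mixFF (m + 1))) -
              lin4 (cE₂ * (Lc : ℝ) ^ (2 * (d + 1))) (unitK (sfStep Lc (m + 1)) (smStep d Lc (m + 1)) (KInvStep (d := d) Lc (m + 1))) Lc
                    (unitS₂ (sfStep Lc (m + 1)) (smStep d Lc (m + 1)) (T2Of d Lc cE cVH cΛ cE₂ cB Tc (vh₂SAt (toSite r) Lc) mixFF (m + 1)))) +
            ((fun κ u κ' u' => (cE₂ * (Lc : ℝ) ^ (2 * (d + 1))) • mmRead Lc (K3OfK (unitK (sfStep Lc (m + 2)) (smStep d Lc (m + 2)) (KInvStep (d := d) Lc (m + 2))) Lc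
                (unitS (sfStep Lc (m + 2)) (smStep d Lc (m + 2)) (Spure d Lc cE cVH cΛ (m + 2))) (unitM (sfStep Lc (m + 2)) (smStep d Lc (m + 2)) (M1 d Lc cΛ (m + 2)))
                (W2SymOfK (unitK (sfStep Lc (m + 2)) (smStep d Lc (m + 2)) (KInvStep (d := d) Lc (m + 2))) Lc (unitS (sfStep Lc (m + 2)) (smStep d Lc (m + 2)) (Spure d Lc cE cVH cΛ (m + 2)))
                (unitM (sfStep Lc (m + 2)) (smStep d Lc (m + 2)) (M1 d Lc cΛ (m + 2))) 0 (unitM₂ (sfStep Lc (m + 2)) (smStep d Lc (m + 2)) (M2Of d Lc mixFF (m + 2)))) κ u κ' u') +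
                cB • mfNeg ((vh₂SAt (toSite r) Lc) κ u κ' u')) -
                  (fun κ u κ' u' => (cE₂ * (Lc : ℝ) ^ (2 * (d + 1))) • mmRead Lc (K3OfK (unitK (sfStep Lc (m + 1)) (smStep d Lc (m + 1)) (KInvStep (d := d) Lc (m + 1))) Lc
                (unitS (sfStep Lc (m + 1)) (smStep d Lc (m + 1)) (Spure d Lc cE cVH cΛ (m + 1))) (unitM (sfStep Lc (m + 1)) (smStep d Lc (m + 1)) (M1 d Lc cΛ (m + 1)))
                (W2SymOfK (unitK (sfStep Lc (m + 1)) (smStep d Lc (m + 1)) (KInvStep (d := d) Lc (m + 1))) Lc (unitS (sfStep Lc (m + 1)) (smStep d Lc (m + 1)) (Spure d Lc cE cVH cΛ (m + 1)))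
                (unitM (sfStep Lc (m + 1)) (smStep d Lc (m + 1)) (M1 d Lc cΛ (m + 1))) 0 (unitM₂ (sfStep Lc (m + 1)) (smStep d Lc (m + 1)) (M2Of d Lc mixFF (m + 1)))) κ u κ' u') +
                cB • mfNeg ((vh₂SAt (toSite r) Lc) κ u κ' u')))) :=
  unitS₂_T2Of_sub_eq_transport_add_sum_from_vh₂SAt_of_mix cE cVH cΛ cE₂ cB Tc mixFF hLc hr hmix 1 n

end AnyRoot

/-! ## §2 (F1a)/(F1b) FROM LEVEL `s` WITH BOTH an1 TABLES AT ROOT `r`: no table hypothesis left -/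

section An1

variable {Lc : ℕ} [NeZero Lc] {r : Fin (d + 1) → ℕ} (cE cVH cΛ cE₂ cB : ℝ) (Tc : Fin 4 → Fin 4 → Fin 4 → Fin 4 → ℝ)

/-- [folklore] **(F1a) FROM LEVEL `s` WITH an1's TABLES `vh₂SAt (toSite r) Lc`, `mixFFAt (toSite r) Lc` PLUGGED IN — NO TABLE HYPOTHESIS**:
§1 at `hmix := MixedJetTablesPlug.hmix_an1 hLc hr`.  Residual binders `1 ≤ Lc`, `r ∈ box (d+1) Lc`.  (`s = 0` is
`T2UnitSplitBorder.unitS₂_T2Of_eq_transport_add_sum_an1`.) -/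
theorem unitS₂_T2Of_eq_transport_add_sum_from_an1 (hLc : 1 ≤ Lc) (hr : r ∈ box (d + 1) Lc) (s n : ℕ) :
    unitS₂ (sfStep Lc (n + s)) (smStep d Lc (n + s)) (T2Of d Lc cE cVH cΛ cE₂ cB Tc (vh₂SAt (toSite r) Lc) (mixFFAt (toSite r) Lc) (n + s)) =
      transport (fun j => lin4 (cE₂ * (Lc : ℝ) ^ (2 * (d + 1))) (unitK (sfStep Lc j) (smStep d Lc j) (KInvStep (d := d) Lc j)) Lc) s n
            (unitS₂ (sfStep Lc s) (smStep d Lc s) (T2Of d Lc cE cVH cΛ cE₂ cB Tc (vh₂SAt (toSite r) Lc) (mixFFAt (toSite r) Lc) s)) +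
        ∑ m ∈ Finset.range n, transport (fun j => lin4 (cE₂ * (Lc : ℝ) ^ (2 * (d + 1))) (unitK (sfStep Lc j) (smStep d Lc j) (KInvStep (d := d) Lc j)) Lc) (m + 1 + s) (n - 1 - m)
              (fun κ u κ' u' => (cE₂ * (Lc : ℝ) ^ (2 * (d + 1))) • mmRead Lc (K3OfK (unitK (sfStep Lc (m + s)) (smStep d Lc (m + s)) (KInvStep (d := d) Lc (m + s))) Lc
                (unitS (sfStep Lc (m + s)) (smStep d Lc (m + s)) (Spure d Lc cE cVH cΛ (m + s))) (unitM (sfStep Lc (m + s)) (smStep d Lc (m + s)) (M1 d Lc cΛ (m + s)))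
                (W2SymOfK (unitK (sfStep Lc (m + s)) (smStep d Lc (m + s)) (KInvStep (d := d) Lc (m + s))) Lc (unitS (sfStep Lc (m + s)) (smStep d Lc (m + s)) (Spure d Lc cE cVH cΛ (m + s)))
                (unitM (sfStep Lc (m + s)) (smStep d Lc (m + s)) (M1 d Lc cΛ (m + s))) 0 (unitM₂ (sfStep Lc (m + s)) (smStep d Lc (m + s)) (M2Of d Lc (mixFFAt (toSite r) Lc) (m + s)))) κ u κ' u') +
                cB • mfNeg ((vh₂SAt (toSite r) Lc) κ u κ' u')) :=
  unitS₂_T2Of_eq_transport_add_sum_from_vh₂SAt_of_mix cE cVH cΛ cE₂ cB Tc (mixFFAt (toSite r) Lc) hLc hr (hmix_an1 hLc hr) s n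

/-- [folklore] **(F1b) FROM LEVEL `s` WITH an1's TABLES PLUGGED IN — NO TABLE HYPOTHESIS**: §1 at `hmix := MixedJetTablesPlug.hmix_an1 hLc hr`.
(`s = 0` is `T2UnitSplitBorder.unitS₂_T2Of_sub_eq_transport_add_sum_an1`.) -/
theorem unitS₂_T2Of_sub_eq_transport_add_sum_from_an1 (hLc : 1 ≤ Lc) (hr : r ∈ box (d + 1) Lc) (s n : ℕ) :
    (fun κ u κ' u' => unitS₂ (sfStep Lc (n + 1 + s)) (smStep d Lc (n + 1 + s)) (T2Of d Lc cE cVH cΛ cE₂ cB Tc (vh₂SAt (toSite r) Lc) (mixFFAt (toSite r) Lc) (n + 1 + s)) κ u κ' u' -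
        unitS₂ (sfStep Lc (n + s)) (smStep d Lc (n + s)) (T2Of d Lc cE cVH cΛ cE₂ cB Tc (vh₂SAt (toSite r) Lc) (mixFFAt (toSite r) Lc) (n + s)) κ u κ' u') =
      transport (fun j => lin4 (cE₂ * (Lc : ℝ) ^ (2 * (d + 1))) (unitK (sfStep Lc j) (smStep d Lc j) (KInvStep (d := d) Lc j)) Lc) (1 + s) n
            (fun κ u κ' u' =>
          unitS₂ (sfStep Lc (1 + s)) (smStep d Lc (1 + s)) (T2Of d Lc cE cVH cΛ cE₂ cB Tc (vh₂SAt (toSite r) Lc) (mixFFAt (toSite r) Lc) (1 + s)) κ u κ' u' -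
            unitS₂ (sfStep Lc s) (smStep d Lc s) (T2Of d Lc cE cVH cΛ cE₂ cB Tc (vh₂SAt (toSite r) Lc) (mixFFAt (toSite r) Lc) s) κ u κ' u') +
        ∑ m ∈ Finset.range n, transport (fun j => lin4 (cE₂ * (Lc : ℝ) ^ (2 * (d + 1))) (unitK (sfStep Lc j) (smStep d Lc j) (KInvStep (d := d) Lc j)) Lc) (m + 2 + s) (n - 1 - m)
          ((lin4 (cE₂ * (Lc : ℝ) ^ (2 * (d + 1))) (unitK (sfStep Lc (m + 1 + s)) (smStep d Lc (m + 1 + s)) (KInvStep (d := d) Lc (m + 1 + s))) Lc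
                (unitS₂ (sfStep Lc (m + s)) (smStep d Lc (m + s)) (T2Of d Lc cE cVH cΛ cE₂ cB Tc (vh₂SAt (toSite r) Lc) (mixFFAt (toSite r) Lc) (m + s))) -
              lin4 (cE₂ * (Lc : ℝ) ^ (2 * (d + 1))) (unitK (sfStep Lc (m + s)) (smStep d Lc (m + s)) (KInvStep (d := d) Lc (m + s))) Lc
                    (unitS₂ (sfStep Lc (m + s)) (smStep d Lc (m + s)) (T2Of d Lc cE cVH cΛ cE₂ cB Tc (vh₂SAt (toSite r) Lc) (mixFFAt (toSite r) Lc) (m + s)))) +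
            ((fun κ u κ' u' => (cE₂ * (Lc : ℝ) ^ (2 * (d + 1))) • mmRead Lc (K3OfK (unitK (sfStep Lc (m + 1 + s)) (smStep d Lc (m + 1 + s)) (KInvStep (d := d) Lc (m + 1 + s))) Lc
                (unitS (sfStep Lc (m + 1 + s)) (smStep d Lc (m + 1 + s)) (Spure d Lc cE cVH cΛ (m + 1 + s))) (unitM (sfStep Lc (m + 1 + s)) (smStep d Lc (m + 1 + s)) (M1 d Lc cΛ (m + 1 + s)))
                (W2SymOfK (unitK (sfStep Lc (m + 1 + s)) (smStep d Lc (m + 1 + s)) (KInvStep (d := d) Lc (m + 1 + s))) Lc (unitS (sfStep Lc (m + 1 + s)) (smStep d Lc (m + 1 + s)) (Spure d Lc cE cVH cΛ (m + 1 + s)))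
                (unitM (sfStep Lc (m + 1 + s)) (smStep d Lc (m + 1 + s)) (M1 d Lc cΛ (m + 1 + s))) 0 (unitM₂ (sfStep Lc (m + 1 + s)) (smStep d Lc (m + 1 + s)) (M2Of d Lc (mixFFAt (toSite r) Lc) (m + 1 + s)))) κ u κ' u') +
                cB • mfNeg ((vh₂SAt (toSite r) Lc) κ u κ' u')) -
                  (fun κ u κ' u' => (cE₂ * (Lc : ℝ) ^ (2 * (d + 1))) • mmRead Lc (K3OfK (unitK (sfStep Lc (m + s)) (smStep d Lc (m + s)) (KInvStep (d := d) Lc (m + s))) Lc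
                (unitS (sfStep Lc (m + s)) (smStep d Lc (m + s)) (Spure d Lc cE cVH cΛ (m + s))) (unitM (sfStep Lc (m + s)) (smStep d Lc (m + s)) (M1 d Lc cΛ (m + s)))
                (W2SymOfK (unitK (sfStep Lc (m + s)) (smStep d Lc (m + s)) (KInvStep (d := d) Lc (m + s))) Lc (unitS (sfStep Lc (m + s)) (smStep d Lc (m + s)) (Spure d Lc cE cVH cΛ (m + s)))
                (unitM (sfStep Lc (m + s)) (smStep d Lc (m + s)) (M1 d Lc cΛ (m + s))) 0 (unitM₂ (sfStep Lc (m + s)) (smStep d Lc (m + s)) (M2Of d Lc (mixFFAt (toSite r) Lc) (m + s)))) κ u κ' u') +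
                cB • mfNeg ((vh₂SAt (toSite r) Lc) κ u κ' u')))) :=
  unitS₂_T2Of_sub_eq_transport_add_sum_from_vh₂SAt_of_mix cE cVH cΛ cE₂ cB Tc (mixFFAt (toSite r) Lc) hLc hr (hmix_an1 hLc hr) s n

/-- [folklore] **(F1b) FROM LEVEL 1 WITH an1's TABLES PLUGGED IN — THE ROOTED `hsplit` OF THE RE-CUT (R1) WITH NO TABLE HYPOTHESIS**, in the
consumer's numerals (`D♮_{n+1} = transport 𝒜 2 n D♮_1 + Σ_{m<n} transport 𝒜 (m+3) (n−1−m) f♮_{m+1}` for the an1 tables at root `r`); residual binders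
`1 ≤ Lc`, `r ∈ box (d+1) Lc`. -/
theorem unitS₂_T2Of_sub_eq_transport_add_sum_one_an1 (hLc : 1 ≤ Lc) (hr : r ∈ box (d + 1) Lc) (n : ℕ) :
    (fun κ u κ' u' => unitS₂ (sfStep Lc (n + 2)) (smStep d Lc (n + 2)) (T2Of d Lc cE cVH cΛ cE₂ cB Tc (vh₂SAt (toSite r) Lc) (mixFFAt (toSite r) Lc) (n + 2)) κ u κ' u' -
        unitS₂ (sfStep Lc (n + 1)) (smStep d Lc (n + 1)) (T2Of d Lc cE cVH cΛ cE₂ cB Tc (vh₂SAt (toSite r) Lc) (mixFFAt (toSite r) Lc) (n + 1)) κ u κ' u') =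
      transport (fun j => lin4 (cE₂ * (Lc : ℝ) ^ (2 * (d + 1))) (unitK (sfStep Lc j) (smStep d Lc j) (KInvStep (d := d) Lc j)) Lc) 2 n
            (fun κ u κ' u' =>
          unitS₂ (sfStep Lc 2) (smStep d Lc 2) (T2Of d Lc cE cVH cΛ cE₂ cB Tc (vh₂SAt (toSite r) Lc) (mixFFAt (toSite r) Lc) 2) κ u κ' u' -
            unitS₂ (sfStep Lc 1) (smStep d Lc 1) (T2Of d Lc cE cVH cΛ cE₂ cB Tc (vh₂SAt (toSite r) Lc) (mixFFAt (toSite r) Lc) 1) κ u κ' u') +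
        ∑ m ∈ Finset.range n, transport (fun j => lin4 (cE₂ * (Lc : ℝ) ^ (2 * (d + 1))) (unitK (sfStep Lc j) (smStep d Lc j) (KInvStep (d := d) Lc j)) Lc) (m + 3) (n - 1 - m)
          ((lin4 (cE₂ * (Lc : ℝ) ^ (2 * (d + 1))) (unitK (sfStep Lc (m + 2)) (smStep d Lc (m + 2)) (KInvStep (d := d) Lc (m + 2))) Lc
                (unitS₂ (sfStep Lc (m + 1)) (smStep d Lc (m + 1)) (T2Of d Lc cE cVH cΛ cE₂ cB Tc (vh₂SAt (toSite r) Lc) (mixFFAt (toSite r) Lc) (m + 1))) -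
              lin4 (cE₂ * (Lc : ℝ) ^ (2 * (d + 1))) (unitK (sfStep Lc (m + 1)) (smStep d Lc (m + 1)) (KInvStep (d := d) Lc (m + 1))) Lc
                    (unitS₂ (sfStep Lc (m + 1)) (smStep d Lc (m + 1)) (T2Of d Lc cE cVH cΛ cE₂ cB Tc (vh₂SAt (toSite r) Lc) (mixFFAt (toSite r) Lc) (m + 1)))) +
            ((fun κ u κ' u' => (cE₂ * (Lc : ℝ) ^ (2 * (d + 1))) • mmRead Lc (K3OfK (unitK (sfStep Lc (m + 2)) (smStep d Lc (m + 2)) (KInvStep (d := d) Lc (m + 2))) Lc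
                (unitS (sfStep Lc (m + 2)) (smStep d Lc (m + 2)) (Spure d Lc cE cVH cΛ (m + 2))) (unitM (sfStep Lc (m + 2)) (smStep d Lc (m + 2)) (M1 d Lc cΛ (m + 2)))
                (W2SymOfK (unitK (sfStep Lc (m + 2)) (smStep d Lc (m + 2)) (KInvStep (d := d) Lc (m + 2))) Lc (unitS (sfStep Lc (m + 2)) (smStep d Lc (m + 2)) (Spure d Lc cE cVH cΛ (m + 2)))
                (unitM (sfStep Lc (m + 2)) (smStep d Lc (m + 2)) (M1 d Lc cΛ (m + 2))) 0 (unitM₂ (sfStep Lc (m + 2)) (smStep d Lc (m + 2)) (M2Of d Lc (mixFFAt (toSite r) Lc) (m + 2)))) κ u κ' u') +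
                cB • mfNeg ((vh₂SAt (toSite r) Lc) κ u κ' u')) -
                  (fun κ u κ' u' => (cE₂ * (Lc : ℝ) ^ (2 * (d + 1))) • mmRead Lc (K3OfK (unitK (sfStep Lc (m + 1)) (smStep d Lc (m + 1)) (KInvStep (d := d) Lc (m + 1))) Lc
                (unitS (sfStep Lc (m + 1)) (smStep d Lc (m + 1)) (Spure d Lc cE cVH cΛ (m + 1))) (unitM (sfStep Lc (m + 1)) (smStep d Lc (m + 1)) (M1 d Lc cΛ (m + 1)))
                (W2SymOfK (unitK (sfStep Lc (m + 1)) (smStep d Lc (m + 1)) (KInvStep (d := d) Lc (m + 1))) Lc (unitS (sfStep Lc (m + 1)) (smStep d Lc (m + 1)) (Spure d Lc cE cVH cΛ (m + 1)))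
                (unitM (sfStep Lc (m + 1)) (smStep d Lc (m + 1)) (M1 d Lc cΛ (m + 1))) 0 (unitM₂ (sfStep Lc (m + 1)) (smStep d Lc (m + 1)) (M2Of d Lc (mixFFAt (toSite r) Lc) (m + 1)))) κ u κ' u') +
                cB • mfNeg ((vh₂SAt (toSite r) Lc) κ u κ' u')))) :=
  unitS₂_T2Of_sub_eq_transport_add_sum_from_an1 cE cVH cΛ cE₂ cB Tc hLc hr 1 n

end An1

end Summit.QuantumFields.BalabanUV.Beta.GAN24.T2UnitSplitFromRoot

end
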